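import Mathlib
import Summits.KontsevichZagierPeriods.Zeta5Search.LongClassCheck52A
import HarnessLib

/-!
# ζ(5) search — long classes of the record ray II-B: the finite frame check for `M = 52`, remaining parts, and `decide52`

Cell `pub-zeta5` (HONEST FRAMING: systematic search; no irrationality claim unless certified), typer seat generation 13.
Kernel evaluation of `LongClass.check52Part` for `(c₀, u) = (0, 2), (1, 0), (1, 1), (1, 2)`, and the unpacked statements
`decide52_J0 / J1 / J2`: every coded tuple (no jump / one jump / two jumps) satisfying `N52` is `good52`.
Pure finite combinatorics; nothing here bears on irrationality.
-/

namespace Summit.KontsevichZagierPeriods.Zeta5Search.LongClass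

set_option maxHeartbeats 1600000 in
/-- The finite check, part `(0, 2)`. -/
theorem check52_02 : check52Part 0 2 = true := by decide +kernel

set_option maxHeartbeats 800000 in
/-- The finite check, part `(1, 0)`. -/
theorem check52_10 : check52Part 1 0 = true := by decide +kernel

set_option maxHeartbeats 800000 in
/-- The finite check, part `(1, 1)`. -/
theorem check52_11 : check52Part 1 1 = true := by decide +kernel

set_option maxHeartbeats 800000 in
/-- The finite check, part `(1, 2)`. -/
theorem check52_12 : check52Part 1 2 = true := by decide +kernel

/-- All six parts. -/
theorem check52_all {c0 u : ℕ} (hc0 : c0 ≤ 1) (hu : u ≤ 2) : check52Part c0 u = true := by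
  interval_cases c0 <;> interval_cases u
  exacts [check52_00, check52_01, check52_02, check52_10, check52_11, check52_12]

/-- **No jump**: every coded tuple satisfying the constraints is good. -/
theorem decide52_J0 {c0 u kc : ℕ} (hc0 : c0 ≤ 1) (hu : u ≤ 2) (hkc : kc ≤ 1)
    (hN : N52 (mk52 c0 u 41 18 0 0 kc) = true) : good52 (mk52 c0 u 41 18 0 0 kc) = true := by
  have h := check52_all hc0 hu
  simp only [check52Part, Bool.and_eq_true, List.all_eq_true, List.mem_range] at h
  have := h.1.1 kc (by omega)
  rw [hN] at this; simpa using this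

/-- **One jump**: every coded tuple satisfying the constraints is good. -/
theorem decide52_J1 {c0 u k1 e1 kc : ℕ} (hc0 : c0 ≤ 1) (hu : u ≤ 2) (hk1 : k1 ≤ 40) (he1 : e1 ≤ 1) (hkc : kc ≤ 1)
    (hN : N52 (mk52 c0 u k1 18 e1 0 kc) = true) : good52 (mk52 c0 u k1 18 e1 0 kc) = true := by
  have h := check52_all hc0 hu
  simp only [check52Part, Bool.and_eq_true, List.all_eq_true, List.mem_range] at h
  have := h.1.2 k1 (by omega) e1 (by omega) kc (by omega)
  rw [hN] at this; simpa using this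

/-- **Two jumps**: every coded tuple satisfying the constraints is good. -/
theorem decide52_J2 {c0 u k1 d e1 e2 kc : ℕ} (hc0 : c0 ≤ 1) (hu : u ≤ 2) (hk1 : k1 ≤ 17) (hd : d ≤ 17) (he1 : e1 ≤ 1)
    (he2 : e2 ≤ 1) (hkc : kc ≤ 1) (hN : N52 (mk52 c0 u k1 d e1 e2 kc) = true) : good52 (mk52 c0 u k1 d e1 e2 kc) = true := by
  have h := check52_all hc0 hu
  simp only [check52Part, Bool.and_eq_true, List.all_eq_true, List.mem_range] at h
  have := h.2 k1 (by omega) d (by omega) e1 (by omega) e2 (by omega) kc (by omega)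
  rw [hN] at this; simpa using this

end Summit.KontsevichZagierPeriods.Zeta5Search.LongClass
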